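import Mathlib
import Summits.PneNP.PneNP.Theses.ConvexRankGates
import Literature.Computability.AlgebraicComplexity.PermanentVsDeterminant
import Literature.Computability.AlgebraicComplexity.DeterminantalComplexity
import Literature.Computability.AlgebraicComplexity.ValiantClasses

/-!
# Sketch — crux-ideate stmt-PneNP-10681 (LinAlgGateBlind), ideator 3, round 1

First-lemma signatures for the idea cards (elaboration only; nothing here is proved).
-/

namespace Summit.PneNP.PneNP.Cruxes.LinAlgGateBlind.Sketch3

open scoped BigOperators Classical
open Literature.Computability.Complexity Literature.Computability.AlgebraicComplexity MvPolynomial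

noncomputable section

/-- The GRANK half of the crux's gate class `Lin s` (copied from the route file). -/
def GRank (s : ℕ) : Set GateFn :=
  {g | ∃ (F : Type) (_ : Field F) (d θ : ℕ), d ≤ s ∧ ∃ (K₀ : Matrix (Fin d) (Fin d) F)
      (K : Fin g.1 → Matrix (Fin d) (Fin d) F), ∀ v : Fin g.1 → Bool, g.2 v = true ↔
        θ ≤ (K₀.map (algebraMap F (FractionRing (MvPolynomial (Fin g.1) F))) +
          ∑ i, if v i then (algebraMap (MvPolynomial (Fin g.1) F)
            (FractionRing (MvPolynomial (Fin g.1) F)) (MvPolynomial.X i)) •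
              (K i).map (algebraMap F (FractionRing (MvPolynomial (Fin g.1) F))) else 0).rank}

/-- Edge type of `K_m`, as in the route file. -/
abbrev Edge (m : ℕ) : Type := ((⊤ : SimpleGraph (Fin m)).edgeSet)

/-- The inline clique function of the route (rfl-equal to `cliqueFn m k`). -/
def cliqueFun (m k : ℕ) (x : Edge m → Bool) : Bool :=
  decide (¬ (SimpleGraph.fromEdgeSet {e : Sym2 (Fin m) |
    ∃ h : e ∈ (⊤ : SimpleGraph (Fin m)).edgeSet, x ⟨e, h⟩ = true}).CliqueFree k)

/-! ## Card 1 — determinantal shadows -/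

/-- CALIBRATION (card 1, first lemma; provable now, see NOTES `## Barrier notes` B1):
the crux implies Valiant's hypothesis in determinantal form over every field of characteristic
`≠ 2` (`DcPerSuperpolynomial`, pnp.S05; for `k = ℂ` this is item stmt-ValiantsHypothesis-0320). -/
def ValiantCalibration : Prop :=
  Summit.PneNP.PneNP.Theses.ConvexRankGates.LinAlgGateBlind →
    ∀ (k : Type) [Field k], ringChar k ≠ 2 → DcPerSuperpolynomial k

/-- The clique-cover polynomial `CC_{m,k} = Σ_{|S|=k} Π_{e ⊆ S} x_e · Π_{e ⊄ S} (1 + z_e x_e)`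
(variables `Sum.inl e = x_e`, `Sum.inr e = z_e`). Its monotone shadow in the `x`-variables is
`CLIQUE(m,k)` and it lies in `VNP` (Valiant's criterion). -/
def cliqueCover (m k : ℕ) (F : Type) [Field F] : MvPolynomial (Edge m ⊕ Edge m) F :=
  ∑ S ∈ (Finset.univ : Finset (Fin m)).powersetCard k,
    ∏ e : Edge m, (if (∀ v ∈ (e : Sym2 (Fin m)), v ∈ S) then X (Sum.inl e)
      else 1 + X (Sum.inr e) * X (Sum.inl e))

/-- Monotone shadow of a polynomial in `x ⊕ z` variables on an edge set `E`: zero the `x_e`,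
`e ∉ E`, keep everything else, and ask for non-vanishing. -/
def shadow {m : ℕ} {ι F : Type} [Field F] (f : MvPolynomial (Edge m ⊕ ι) F)
    (E : Set (Edge m)) : Prop :=
  MvPolynomial.aeval (R := F) (S₁ := MvPolynomial (Edge m ⊕ ι) F)
    (Sum.elim (fun e => if e ∈ E then X (Sum.inl e) else 0) (fun i => X (Sum.inr i))) f ≠ 0

/-- Shadow lemma (card 1): the shadow of `CC_{m,k}` is exactly `CLIQUE(m,k)`. -/
def ShadowCliqueCover : Prop :=
  ∀ (m k : ℕ) (F : Type) [Field F] (x : Edge m → Bool),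
    shadow (cliqueCover m k F) {e | x e = true} ↔ cliqueFun m k x = true

/-- `CC` is a `VNP` family (for any p-bounded choice of `k`), by Valiant's criterion. -/
def CliqueCoverVNP : Prop :=
  ∀ (F : Type) [Field F] (kf : ℕ → ℕ), (∀ m, kf m ≤ m) →
    IsVNPFamily (σ := fun m => Edge m ⊕ Edge m) (fun m => cliqueCover m (kf m) F)

/-- ONE-GATE LEMMA (card 1): an affine determinantal representation of size `D` of ANY
polynomial whose shadow is `CLIQUE(m,k)` is a size-1 circuit over `GRank D` computing
`CLIQUE(m,k)` (field of the gate: `F(z)`; `θ = D`). -/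
def OneGateOfDetShadow : Prop :=
  ∀ (m k D : ℕ) (F ι : Type) [Field F] [Fintype ι] (f : MvPolynomial (Edge m ⊕ ι) F),
    HasDetRepr f D → (∀ x : Edge m → Bool, shadow f {e | x e = true} ↔ cliqueFun m k x = true) →
      ∃ C : Circuit (Edge m), C.IsOver (GRank D) ∧ C.size = 1 ∧ C.Computes (cliqueFun m k)

/-- KERNEL (card 1, the isolated Valiant-hard residue, distributional form): no nonzero
polynomial over any field, all of whose monomials contain (the edge set of) a `k`-clique in
their support and which has exact-support witnesses for at least a `1/m^c` fraction of the
`k`-cliques, has an affine determinantal representation of size `m^c` (`k = ⌈m^δ⌉`,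
eventually in `m`, for some `δ`). -/
def CliqueIdealKernel : Prop :=
  ∃ δ : ℝ, 0 < δ ∧ δ < 1 / 2 ∧ ∀ c : ℕ, ∀ᶠ m : ℕ in Filter.atTop,
    ∀ (F : Type) [Field F] (g : MvPolynomial (Edge m) F), g ≠ 0 →
      (∀ mono ∈ g.support, ∃ S : Finset (Fin m), S.card = ⌈(m : ℝ) ^ δ⌉₊ ∧
        ∀ e : Edge m, (∀ v ∈ (e : Sym2 (Fin m)), v ∈ S) → mono e ≠ 0) →
      (m.choose ⌈(m : ℝ) ^ δ⌉₊ ≤ m ^ c *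
        (((Finset.univ : Finset (Fin m)).powersetCard ⌈(m : ℝ) ^ δ⌉₊).filter fun S =>
          ∃ mono ∈ g.support, ∀ e : Edge m,
            mono e ≠ 0 ↔ (∀ v ∈ (e : Sym2 (Fin m)), v ∈ S)).card) →
      ¬ HasDetRepr g (m ^ c)

/-- Zero-pattern (fooling-set) rank bound used for the ORDERED-pencil fragment of the kernel:
a matrix containing an "induced matching" of nonzero entries has rank at least its size,
whatever the (wild) values. -/
def FoolingSetRank : Prop :=
  ∀ (F : Type) [Field F] (ι κ : Type) [Fintype ι] [Fintype κ] [DecidableEq κ]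
    (M : Matrix ι κ F) (t : ℕ) (r : Fin t → ι) (c : Fin t → κ),
    (∀ i, M (r i) (c i) ≠ 0) → (∀ i j, i ≠ j → M (r i) (c j) = 0) → t ≤ M.rank

/-- Read-once fragment, `k = 3` (proved on paper this session): for `m ≥ 11` the triangles of
`K_m` are not the common independent 3-sets of ANY two matroids on `Sym2 (Fin m)`; hence no
read-once rank-one GRANK gate (= truncated matroid intersection, Cauchy–Binet) computes
TRIANGLE exactly. -/
def TrianglesNotMatroidIntersection : Prop :=
  ∀ m : ℕ, 11 ≤ m → ¬ ∃ M₁ M₂ : Matroid (Sym2 (Fin m)), ∀ T : Finset (Sym2 (Fin m)),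
    T.card = 3 → ((M₁.Indep (T : Set (Sym2 (Fin m))) ∧ M₂.Indep (T : Set (Sym2 (Fin m)))) ↔
      ∃ a b c : Fin m, a ≠ b ∧ b ≠ c ∧ a ≠ c ∧ T = {s(a, b), s(b, c), s(a, c)})

/-! ## Card 2 — PERM absorption via closure programs over `l`-terms -/

/-- Normal form (card 2): a PERM gate fed with DNFs is a "closure program over terms":
`τ ∈ ⟨σ_i : some term of 𝒯_i lies inside E⟩`. (Trivial; fixes the object the card studies.) -/
def PermOverTerms : Prop :=
  ∀ (m d r : ℕ) (σ : Fin r → Equiv.Perm (Fin d)) (τ : Equiv.Perm (Fin d))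
    (𝒯 : Fin r → Finset (Finset (Edge m))) (E : Finset (Edge m)),
    τ ∈ Subgroup.closure (σ '' {i | ∃ t ∈ 𝒯 i, t ⊆ E}) ↔
      τ ∈ Subgroup.closure (⋃ t ∈ {t : Finset (Edge m) | t ⊆ E}, σ '' {i | t ∈ 𝒯 i})

/-- RANK MEASURE WITH ARBITRARY MONOTONE ROW LABELS (card 2, first lemma; Gál 2001 for
variable labels, same proof): if a span program over `F` whose rows are switched on by monotone
label functions `ℓ_i` (here: `l`-terms) accepts exactly `f⁻¹(1)`, then for every matrix `A` on
positives × negatives, `rank A ≤ Σ_i rank (A ∘ 1[ℓ_i(u)=1, ℓ_i(v)=0])`. This is the absorption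
invariant for abelian (field) PERM gates fed by `(l,p)`-approximators. -/
def LabelledRankMeasure : Prop :=
  ∀ (F : Type) [Field F] (ι : Type) [Fintype ι] (d R : ℕ) (rows : Fin R → (Fin d → F))
    (lab : Fin R → ((ι → Bool) → Bool)) (t : Fin d → F) (f : (ι → Bool) → Bool),
    (∀ i, Monotone (lab i)) →
    (∀ x, f x = true ↔ t ∈ Submodule.span F (rows '' {i | lab i x = true})) →
    ∀ (U V : Finset (ι → Bool)), (∀ u ∈ U, f u = true) → (∀ v ∈ V, f v = false) →
      ∀ A : Matrix U V F,
        A.rank ≤ ∑ i, (Matrix.of fun (u : U) (v : V) =>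
          if lab i u = true ∧ lab i v = false then A u v else 0).rank

end

end Summit.PneNP.PneNP.Cruxes.LinAlgGateBlind.Sketch3
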